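import Summits.HodgeConjecture.HodgeConjecture.Theorems.F0P3cStCharTSM1hOfCharH       -- ★ (this seat) S12b «M1H-OF-CHARH★»: `packetCharHRegularity_of_singleton` (brings ★ SocketsOut, ★ Ch12Sec5Inputs, `IsLocSmooth`, `Gqs`)
import Summits.HodgeConjecture.HodgeConjecture.Theorems.F0P3cStCharTSCharField          -- ★ (LH6-p01) S1 «CHAR-FIELD★»: `exists_charRegular_of_characterLocallyIntegrable_of_nonsplit` (generic `N`), named fact ★ `Ch1.characterLocallyIntegrable`
import Literature.NumberTheory.Rogawski1990.LocalTransfer                                -- ★ `IsLocalGRegular`, `IsLocalStablyConjH` (the pins' tokens)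
import Literature.NumberTheory.Rogawski1990.LocalCentralizerTorusMeasureCM               -- ★ `isRegularElt_fst_snd_of_isLocalGRegular`
import Summits.HodgeConjecture.HodgeConjecture.Theorems.F0P3cStCharTSBoxCharFn         -- ★ (F0P2-p02 g19) p851425 «BOXCHAR-FN★»: `smoothTrace_boxChar_eq_integral`, `measurable_boxCharFn`, `locallyIntegrable_boxCharFn`, `eventually_boxCharFn_eq`
import Literature.NumberTheory.Automorphic.UnitaryGroupPrincipalSeriesHLattice            -- ★ `HLengthTwoLabels.exists_eq_boxChar` (πSt = πSt₂ ⊠ χ₁)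
import Summits.HodgeConjecture.HodgeConjecture.Theorems.F0P3XiPacketFamilyOfRecord       -- ★ `isAdmissible_of_isConstituentOf`
import Literature.NumberTheory.Automorphic.SmoothInductionAdmissibleOfCocompact          -- ★ `isAdmissible_cmPrincipalSeries_of_iwasawa`
import Literature.NumberTheory.Automorphic.UnitaryGroupCMLocalIwasawa                    -- ★ `exists_borel_mul_mem_cmLocalIntegralLevel`
import Summits.HodgeConjecture.HodgeConjecture.Theorems.F0P3bHPrincipalSeriesJHOfUTwo    -- ★ `isOpen_ker_of_continuous_unitsComplex`; ★ `nonarchimedeanGroup_unitaryGroupOfForm_local`, `continuous_torusLocalComponent`, `continuous_localDet`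
import Literature.NumberTheory.Rogawski1990.LocalTransferUnmatchedLocus                  -- ★ `compactSpace_cmDatum_local_one_of_smul_eq` (`U(Φ₁)(L⁺_v)` compact at non-split `v`)
import Literature.NumberTheory.Automorphic.LocalUnitaryGroupCongr                        -- ★ `antidiagOne_isHermitian`, `isUnit_antidiagOne_det`
import HarnessLib

/-!
# F0 · P3c · line LH6 «StCharTS» — «H-FIELDS» (datum road, MAP v4 §3 row `charH cartanH μTH DH regH ellH stConjH`): the H-side FIELD PINS of the §12.5 datum
# on `H_v = U(Φ₂)(L⁺_v) × U(Φ₁)(L⁺_v)` and what they discharge — (E⊆R)_H, and the socket (M1H) at the Steinberg packet [Rogawski1990, §12.5 pp. 183–184; §1.6 p. 5]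

Cell `pub/hodgecm-mathlib`, crux H413 = `stmt-HodgeConjecture-24833` (lane `--supports …`), route HCCMUnconditional; seat F0P2-p01 (g21) (free P2 hand; slice (B)
«H-FIELDS» dealt by the map owner LH6-p01 (g4) 12:06:38Z∕12:07:33Z).  THEOREMS ONLY (no definition ∕ instance ∕ notation ∕ named fact ∕ `sorry`); ★-only imports.

WHAT.  The rung-0 theorem for the (S-𝔇) organ `stub_EllipticPackage` (`Cruxes/H413/Lines/F0_P3c_StCharTSPaydown.lean`, ED. 17) takes the printed inputs as ONE
hypothesis «∀ 𝔇, COMPAT ∧ FIELDS → NAMED»; that hypothesis is print-true only if every field a named conjunct READS is pinned to print's object (MAP v4 §3).  The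
H-side fields `regH ellH stConjH charH cartanH μTH DH` are read by (M1H) (UPR) (U2) (M5) (DEF-H), PROPOSITION 12.5.2 and `UpSpec`.  This file fixes their
FIELD-EQUATION TEXTS (road rule §2.1: equations∕`↔` on an abstract `𝔇`, discharged by `rfl`∕`Iff.rfl` at ★ `F0P3cStCharTSDatumWitness.exists_datum_with_fields`,
which already takes `regH ellH stConjH charH SH DHf μTHf` as parameters) and proves what they discharge:
* (P1) **hStH** `∀ a b, 𝔇.stConjH a b ↔ IsLocalStablyConjH L v a b` — componentwise stable conjugacy on `H_v` (★ `LocalTransfer`; [§3.1 p. 19]); = LH4-p01 (g5)'s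
  S13-CENSUS §7 text (the (UP-DEF) `finsum` over `Quot (IsLocalStablyConjH L v)` is well defined against it).
* (P2) **hRegH** `∀ a, a ∈ 𝔇.regH ↔ IsLocalGRegular L v a` — print's `H^r` [§12.5 p. 183 «Let `α` be a stable class function on `H^r`»] READ ON THE `G`-REGULAR
  LOCUS, the set on which the organ's transfer is stated (`mHv.IsCanonical (IsLocalGRegular L v)`); `H`-regular ∖ `G`-regular is null on every torus; = LH4-p01 §7.
  EFFECT OF THIS PIN (map owner's word 12:26Z, recorded): stability of `χ_ρ` is asserted∕assumed only on the SMALLER `G`-regular set, so the socket (M1H) becomes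
  (slightly) weaker and the antecedent «`α` stable on `regH`» of the NAMED carpet `UpSpec` weaker — i.e. `UpSpec` as a named input becomes formally slightly
  stronger than with an `H`-regular pin, but stays print-true: `α^G` depends on `α` only through its values almost everywhere [§12.5 p. 183, L. 12.5.1].
* (P3) **hEH** `∀ a, a ∈ 𝔇.ellH ↔ IsLocalGRegular L v a ∧ IsCompact (Z_H(a))` — print's `H^e` = «elliptic regular elements» [§12.5 p. 184] with «elliptic» =
  «the Cartan subgroup `Z(a)` is compact» (the road's `hcart` currency; the centre of `H_v` is compact at a non-split `v`); for `a = (γ₂, γ₁)`,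
  `Z_H(a) = Z_{U(Φ₂)}(γ₂) × U(Φ₁)` is compact iff `γ₂` is `U(2)`-elliptic.  §1 derives the coherence (E⊆R)_H `𝔇.ellH ⊆ 𝔇.regH` [p. 184] from (P2)(P3)
  (`ellH_subset_regH_of_pins`) — the `hEHR` binder of ★ `packetCharHRegularity_of_regH` ∕ ★ S12b.
* (P4) **hcharSt** — the H-twin of the junction's `hchar`, AT THE STEINBERG LABEL `πSt` (with `sqPacketsH = {{πSt}}`, the only H-character the organ reads is
  `packetCharH {πSt} = charH πSt`): `charH πSt` measurable, locally integrable for `μH`, locally constant at every point of `regH`, representing `Tr πSt` on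
  `C_c^∞(H_v)` [§1.6 p. 5, Harish-Chandra].  Its ★-DISCHARGE «CHAR-FIELD-H★» (Harish-Chandra on `U(Φ₂)` ⊗ the smooth character `ψ_v ∘ det₁` on the compact `U(Φ₁)`, through ★
  `HLengthTwoLabels.exists_eq_boxChar` and F0P2-p02 (g19)'s ★ «BOXCHAR-FN★» `tr (ρ ⊠ χ)(f) = ∫ f · (Θ_ρ ⊗ χ)`) is §3 `exists_charSt`; §2∕§4 show what (P2)(P3)(P4) + hSq buy: the socket (M1H)
  `PacketCharHRegularity` modulo ONE named sentence «`χ_{St_H(ξ_v)}` is a stable class function on `H^r`» [§12.5 p. 183 applied p. 191 to `ρ = St_H(ξ)`; §11.1]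
  (`packetCharHRegularity_of_pins`), via ★ S12b `packetCharHRegularity_of_singleton`.
* (P5) **hcartH** (twin of `hcart`∕`hHaarG`∕`hfinG`; LH4-p02 (g6)'s S12a `hKH`∕`hFH` are its projections — §1 `cartanH_structure_of_pin`):
  `∀ T ∈ 𝔇.cartanH, IsCompact T ∧ (∃ γ₀, IsLocalGRegular L v γ₀ ∧ T = Z_H(γ₀)) ∧ (𝔇.μTH T).IsHaarMeasure ∧ IsFiniteMeasure (𝔇.μTH T)` — supplied at rung 0 by the
  «CARTAN-ELL-H» ∃-fact (elliptic Cartan representatives of `H_v` with Haar probability measures, [§3.6; §12.5 p. 184 «meas(Z∖T) = 1»]).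
* (P6) **hDH** = ★ DG-FIELD's `N = 2` twin on the first component, `DH := DG₂ ∘ Prod.fst` (F0P3-p02 (g20)) [§4.9 p. 54]; `ι`, `tau` are read by no conjunct — no pin.
HONEST LABEL: HC_CM is proved only modulo the 7 printed citations (2 remaining named inputs: hLiu418 = `stmt-HodgeConjecture-24832`, h413 = `stmt-HodgeConjecture-24833`)
until rung 0 closes; this file closes no organ and is count-neutral: it pins fields and re-letters (M1H) as «(P4) + χ_{St_H} stable».

## References
* [Rogawski1990] J. D. Rogawski, *Automorphic Representations of Unitary Groups in Three Variables*, Ann. of Math. Stud. 123 (1990): §1.6 p. 5 (characters as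
  functions); §3.1 p. 19 (stable conjugacy); §3.6 pp. 28–31 (Cartan subgroups); §4.3 p. 42 (`G`-regular elements of `H`); §4.9 p. 54 (`D_H`); §12.5 p. 183
  («stable class function on `H^r`», `α ↦ α^G`), p. 184 (`G^e`, `H^e`, `⟨ , ⟩_{H,e}`, «meas(Z∖T) = 1»); §12.7 p. 191 (`ρ = St_H(ξ)`).
* [HarishChandra1999AdmissibleDistributions] Harish-Chandra (DeBacker–Sally, eds.), *Admissible Invariant Distributions on Reductive p-adic Groups*, ULS 16 (1999), Thm. 16.3.
-/

set_option autoImplicit false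
-- the mandated namespace has the single-problem summit's repeated segment (`HodgeConjecture.HodgeConjecture`)
set_option linter.dupNamespace false

noncomputable section

open NumberField IsDedekindDomain MeasureTheory Filter Topology Set
open scoped Matrix MatrixGroups NNReal ENNReal
open Literature.NumberTheory.Rogawski1990 Literature.NumberTheory.Automorphic Literature.NumberTheory.Automorphic.UnitaryGroup
open Literature.NumberTheory.Rogawski1990.Ch12Sec5

namespace Summit.HodgeConjecture.HodgeConjecture.Cruxes.H413.F0P3cStCharTSHFields

/-! ## §1 Generic: (E⊆R)_H and the S12a projections from the pin SHAPES (abstract carriers, abstract regularity predicate `Reg`) -/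

section Generic

variable {G H : Type} [Group G] [TopologicalSpace G] [IsTopologicalGroup G] [MeasurableSpace G]
  [∀ γ : G, MeasurableSpace (G ⧸ Subgroup.centralizer ({γ} : Set G))] [MeasurableSpace (G ⧸ Subgroup.center G)]
  [Group H] [TopologicalSpace H] [IsTopologicalGroup H] [MeasurableSpace H]

/-- **(E⊆R)_H from the pins (P2)(P3)**: if `regH` is «`Reg`» and `ellH` is «`Reg` ∧ compact centraliser», then `H^e ⊆ H^r` (print p. 184: the elliptic set is a
subset of the regular set by definition). [cite: Rogawski1990, §12.5 pp. 183–184] -/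
theorem ellH_subset_regH_of_pins (𝔇 : EllipticData G H) (Reg : H → Prop)
    (hRegH : ∀ a : H, a ∈ 𝔇.regH ↔ Reg a)
    (hEH : ∀ a : H, a ∈ 𝔇.ellH ↔ Reg a ∧ IsCompact ((Subgroup.centralizer ({a} : Set H) : Subgroup H) : Set H)) :
    𝔇.ellH ⊆ 𝔇.regH :=
  fun a ha => (hRegH a).2 ((hEH a).1 ha).1

/-- **S12a's `hKH`∕`hFH` (and the Haar clause) from (P5)**: the elliptic `H`-representatives are compact and carry finite Haar measures (print: «meas(Z∖T) = 1»,
p. 184). [cite: Rogawski1990, §12.5 p. 184] -/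
theorem cartanH_structure_of_pin (𝔇 : EllipticData G H) (Reg : H → Prop)
    (hcartH : ∀ T ∈ 𝔇.cartanH, IsCompact (T : Set H) ∧ (∃ γ₀ : H, Reg γ₀ ∧ T = Subgroup.centralizer ({γ₀} : Set H)) ∧
      (𝔇.μTH T).IsHaarMeasure ∧ IsFiniteMeasure (𝔇.μTH T)) :
    (∀ T ∈ 𝔇.cartanH, IsCompact (T : Set H)) ∧ (∀ T ∈ 𝔇.cartanH, (𝔇.μTH T).IsHaarMeasure) ∧ ∀ T ∈ 𝔇.cartanH, IsFiniteMeasure (𝔇.μTH T) :=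
  ⟨fun T hT => (hcartH T hT).1, fun T hT => (hcartH T hT).2.2.1, fun T hT => (hcartH T hT).2.2.2⟩

/-- **(M1H) from the pins, generic form**: at a datum with (P2)(P3)-shaped `regH`∕`ellH`, a single square-integrable `H`-packet `{πSt}` (hSq), the (P4) clauses for
`charH πSt` (measurable, locally integrable, representing `Tr πSt` — the local-constancy clause is not needed here) and the named residue «`χ_{πSt}` is a stable class
function on `H^r`», the socket (M1H) `PacketCharHRegularity` holds (★ S12b `packetCharHRegularity_of_singleton`). [cite: Rogawski1990, §1.6 p. 5; §12.5 pp. 183–184] -/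
theorem packetCharHRegularity_of_pins_generic [OpensMeasurableSpace H] [T2Space H] (𝔇 : EllipticData G H) (Reg : H → Prop) (πSt : IrrClass H)
    (hRegH : ∀ a : H, a ∈ 𝔇.regH ↔ Reg a)
    (hEH : ∀ a : H, a ∈ 𝔇.ellH ↔ Reg a ∧ IsCompact ((Subgroup.centralizer ({a} : Set H) : Subgroup H) : Set H))
    (hSq : 𝔇.sqPacketsH = {({πSt} : Finset (IrrClass H))})
    (hm : Measurable (𝔇.charH πSt)) (hli : LocallyIntegrable (𝔇.charH πSt) 𝔇.μH)
    (htr : ∀ fH : H → ℂ, IsLocSmooth fH → πSt.smoothTrace 𝔇.μH fH = ∫ h, fH h * 𝔇.charH πSt h ∂𝔇.μH)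
    (hstabSt : IsStableClassFunOn 𝔇.stConjH 𝔇.regH (𝔇.charH πSt)) :
    𝔇.PacketCharHRegularity :=
  F0P3cStCharTSM1hOfCharH.packetCharHRegularity_of_singleton 𝔇 πSt hSq (ellH_subset_regH_of_pins 𝔇 Reg hRegH hEH) hm hli htr hstabSt

end Generic


/-! ## §2 The pins on the organ's carriers `(U(Φ₃)(L⁺_v), H_v)`, `H_v = U(Φ₂)(L⁺_v) × U(Φ₁)(L⁺_v)`, and what they discharge -/

section U3

variable (L : Type) [Field L] [NumberField L] [IsCMField L] (v : HeightOneSpectrum (𝓞 ↥(maximalRealSubfield L)))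

/-- **`G`-regular elements of `H_v` have a `U(2)`-regular first component** (the block-diagonal `ι(γ₂, γ₁)` has three distinct eigenvalues, so `γ₂` has two) — the
link between pin (P2) (`regH := {IsLocalGRegular}`) and Harish-Chandra's local constancy of `χ` on the `U(Φ₂)`-regular set. [cite: Rogawski1990, §4.3 p. 42] -/
theorem isRegularElt_fst_of_isLocalGRegular
    (a : (UnitaryGroup.cmDatum L 2 (Matrix.of fun i j : Fin 2 => if i.val + j.val + 1 = 2 then (1 : L) else 0)).Local v ×
      (UnitaryGroup.cmDatum L 1 (Matrix.of fun i j : Fin 1 => if i.val + j.val + 1 = 1 then (1 : L) else 0)).Local v)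
    (ha : IsLocalGRegular L v a) : IsRegularElt (a.1.val : GL (Fin 2) (UnitaryGroup.LocalRing L v)) :=
  (isRegularElt_fst_snd_of_isLocalGRegular L v a ha).1


/-- **The organ's `χ₁ = ψ_v ∘ det₁` is continuous** (★ `continuous_torusLocalComponent`, ★ `continuous_localDet`) — discharges the `hχ₁c` binder of §3∕§4 at the
organ's labels. [cite: Rogawski1990, §12.1 p. 171] -/
theorem continuous_psi_comp_localDet (ψ : ↥(Arthur2013.Leaves.TECR.TorusDict.torus (IsCMField.complexConj L)) →ₜ* ℂˣ) :
    Continuous fun x : (UnitaryGroup.cmDatum L 1 (Matrix.of fun i j : Fin 1 => if i.val + j.val + 1 = 1 then (1 : L) else 0)).Local v =>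
      ((((torusLocalComponent L (IsCMField.complexConj L) v ψ).comp
          (localDet (IsCMField.complexConj L) v (isUnit_antidiagOne_det L 1))) x : ℂˣ) : ℂ) :=
  (continuous_torusLocalComponent L (IsCMField.complexConj L) (v := v) ψ).comp
    (continuous_localDet (IsCMField.complexConj L) v (isUnit_antidiagOne_det L 1)
      (J := Matrix.of fun i j : Fin 1 => if i.val + j.val + 1 = 1 then (1 : L) else 0))

/-- **(E⊆R)_H ON `H_v` from (P2)(P3)** — the junction's `hEHRH`. [cite: Rogawski1990, §12.5 pp. 183–184] -/
theorem ellH_subset_regH_HLoc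
    [MeasurableSpace (Gqs L v)]
    [∀ γ : Gqs L v, MeasurableSpace (Gqs L v ⧸ Subgroup.centralizer ({γ} : Set (Gqs L v)))]
    [MeasurableSpace (Gqs L v ⧸ Subgroup.center (Gqs L v))]
    [MeasurableSpace ((UnitaryGroup.cmDatum L 2 (Matrix.of fun i j : Fin 2 => if i.val + j.val + 1 = 2 then (1 : L) else 0)).Local v ×
      (UnitaryGroup.cmDatum L 1 (Matrix.of fun i j : Fin 1 => if i.val + j.val + 1 = 1 then (1 : L) else 0)).Local v)]
    (𝔇 : EllipticData (Gqs L v)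
      ((UnitaryGroup.cmDatum L 2 (Matrix.of fun i j : Fin 2 => if i.val + j.val + 1 = 2 then (1 : L) else 0)).Local v ×
        (UnitaryGroup.cmDatum L 1 (Matrix.of fun i j : Fin 1 => if i.val + j.val + 1 = 1 then (1 : L) else 0)).Local v))
    (hRegH : ∀ a, a ∈ 𝔇.regH ↔ IsLocalGRegular L v a)
    (hEH : ∀ a, a ∈ 𝔇.ellH ↔ IsLocalGRegular L v a ∧
      IsCompact ((Subgroup.centralizer ({a} : Set ((UnitaryGroup.cmDatum L 2 (Matrix.of fun i j : Fin 2 => if i.val + j.val + 1 = 2 then (1 : L) else 0)).Local v ×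
        (UnitaryGroup.cmDatum L 1 (Matrix.of fun i j : Fin 1 => if i.val + j.val + 1 = 1 then (1 : L) else 0)).Local v)) :
          Subgroup ((UnitaryGroup.cmDatum L 2 (Matrix.of fun i j : Fin 2 => if i.val + j.val + 1 = 2 then (1 : L) else 0)).Local v ×
        (UnitaryGroup.cmDatum L 1 (Matrix.of fun i j : Fin 1 => if i.val + j.val + 1 = 1 then (1 : L) else 0)).Local v)) :
        Set ((UnitaryGroup.cmDatum L 2 (Matrix.of fun i j : Fin 2 => if i.val + j.val + 1 = 2 then (1 : L) else 0)).Local v ×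
        (UnitaryGroup.cmDatum L 1 (Matrix.of fun i j : Fin 1 => if i.val + j.val + 1 = 1 then (1 : L) else 0)).Local v))) :
    𝔇.ellH ⊆ 𝔇.regH :=
  ellH_subset_regH_of_pins 𝔇 (IsLocalGRegular L v) hRegH hEH

/-- **(M1H) ON `(U(Φ₃)(L⁺_v), H_v)` FROM THE PINS** — the junction's binder list: COMPAT `𝔇.μH = νHv`, (P2) hRegH, (P3) hEH, hSq `sqPacketsH = {{πSt}}`, the (P4)
clauses for `charH πSt` against `νHv` (CHAR-FIELD-H★ discharges them), and the named residue `hstabSt` «`χ_{St_H(ξ_v)}` is a stable class function on `H^r`»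
[§12.5 p. 183; §12.7 p. 191] give the socket (M1H) `PacketCharHRegularity` of (S-𝔇).
[cite: Rogawski1990, §1.6 p. 5; §12.5 pp. 183–184; §12.7 p. 191] [cite: HarishChandra1999AdmissibleDistributions, Thm. 16.3] -/
theorem packetCharHRegularity_of_pins
    [MeasurableSpace (Gqs L v)]
    [∀ γ : Gqs L v, MeasurableSpace (Gqs L v ⧸ Subgroup.centralizer ({γ} : Set (Gqs L v)))]
    [MeasurableSpace (Gqs L v ⧸ Subgroup.center (Gqs L v))]
    [MeasurableSpace ((UnitaryGroup.cmDatum L 2 (Matrix.of fun i j : Fin 2 => if i.val + j.val + 1 = 2 then (1 : L) else 0)).Local v ×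
      (UnitaryGroup.cmDatum L 1 (Matrix.of fun i j : Fin 1 => if i.val + j.val + 1 = 1 then (1 : L) else 0)).Local v)]
    [BorelSpace ((UnitaryGroup.cmDatum L 2 (Matrix.of fun i j : Fin 2 => if i.val + j.val + 1 = 2 then (1 : L) else 0)).Local v ×
      (UnitaryGroup.cmDatum L 1 (Matrix.of fun i j : Fin 1 => if i.val + j.val + 1 = 1 then (1 : L) else 0)).Local v)]
    (νHv : Measure ((UnitaryGroup.cmDatum L 2 (Matrix.of fun i j : Fin 2 => if i.val + j.val + 1 = 2 then (1 : L) else 0)).Local v ×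
      (UnitaryGroup.cmDatum L 1 (Matrix.of fun i j : Fin 1 => if i.val + j.val + 1 = 1 then (1 : L) else 0)).Local v))
    (𝔇 : EllipticData (Gqs L v)
      ((UnitaryGroup.cmDatum L 2 (Matrix.of fun i j : Fin 2 => if i.val + j.val + 1 = 2 then (1 : L) else 0)).Local v ×
        (UnitaryGroup.cmDatum L 1 (Matrix.of fun i j : Fin 1 => if i.val + j.val + 1 = 1 then (1 : L) else 0)).Local v))
    (πSt : IrrClass ((UnitaryGroup.cmDatum L 2 (Matrix.of fun i j : Fin 2 => if i.val + j.val + 1 = 2 then (1 : L) else 0)).Local v ×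
      (UnitaryGroup.cmDatum L 1 (Matrix.of fun i j : Fin 1 => if i.val + j.val + 1 = 1 then (1 : L) else 0)).Local v))
    (hμH : 𝔇.μH = νHv)
    (hRegH : ∀ a, a ∈ 𝔇.regH ↔ IsLocalGRegular L v a)
    (hEH : ∀ a, a ∈ 𝔇.ellH ↔ IsLocalGRegular L v a ∧
      IsCompact ((Subgroup.centralizer ({a} : Set ((UnitaryGroup.cmDatum L 2 (Matrix.of fun i j : Fin 2 => if i.val + j.val + 1 = 2 then (1 : L) else 0)).Local v ×
        (UnitaryGroup.cmDatum L 1 (Matrix.of fun i j : Fin 1 => if i.val + j.val + 1 = 1 then (1 : L) else 0)).Local v)) :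
          Subgroup ((UnitaryGroup.cmDatum L 2 (Matrix.of fun i j : Fin 2 => if i.val + j.val + 1 = 2 then (1 : L) else 0)).Local v ×
        (UnitaryGroup.cmDatum L 1 (Matrix.of fun i j : Fin 1 => if i.val + j.val + 1 = 1 then (1 : L) else 0)).Local v)) :
        Set ((UnitaryGroup.cmDatum L 2 (Matrix.of fun i j : Fin 2 => if i.val + j.val + 1 = 2 then (1 : L) else 0)).Local v ×
        (UnitaryGroup.cmDatum L 1 (Matrix.of fun i j : Fin 1 => if i.val + j.val + 1 = 1 then (1 : L) else 0)).Local v)))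
    (hSq : 𝔇.sqPacketsH = {({πSt} : Finset (IrrClass ((UnitaryGroup.cmDatum L 2 (Matrix.of fun i j : Fin 2 => if i.val + j.val + 1 = 2 then (1 : L) else 0)).Local v ×
      (UnitaryGroup.cmDatum L 1 (Matrix.of fun i j : Fin 1 => if i.val + j.val + 1 = 1 then (1 : L) else 0)).Local v)))})
    (hcharSt : Measurable (𝔇.charH πSt) ∧ LocallyIntegrable (𝔇.charH πSt) νHv ∧
      (∀ x ∈ 𝔇.regH, ∀ᶠ y in 𝓝 x, 𝔇.charH πSt y = 𝔇.charH πSt x) ∧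
      ∀ fH : ((UnitaryGroup.cmDatum L 2 (Matrix.of fun i j : Fin 2 => if i.val + j.val + 1 = 2 then (1 : L) else 0)).Local v ×
          (UnitaryGroup.cmDatum L 1 (Matrix.of fun i j : Fin 1 => if i.val + j.val + 1 = 1 then (1 : L) else 0)).Local v) → ℂ,
        IsLocSmooth fH → πSt.smoothTrace νHv fH = ∫ h, fH h * 𝔇.charH πSt h ∂νHv)
    (hstabSt : IsStableClassFunOn 𝔇.stConjH 𝔇.regH (𝔇.charH πSt)) :
    𝔇.PacketCharHRegularity := by
  subst hμH
  exact packetCharHRegularity_of_pins_generic 𝔇 (IsLocalGRegular L v) πSt hRegH hEH hSq hcharSt.1 hcharSt.2.1 hcharSt.2.2.2 hstabSt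

/-! ## §3 «CHAR-FIELD-H★»: the (P4) clauses at the Steinberg label, from Harish-Chandra on `U(Φ₂)(L⁺_v)` [§1.6 p. 5] ⊗ the smooth character `χ₁` on the
compact `U(Φ₁)(L⁺_v)` — `χ_{St_H}(γ₂, γ₁) = Θ_{St₂}(γ₂) · χ₁(γ₁)` through ★ `HLengthTwoLabels.exists_eq_boxChar` and the box-character identity -/

set_option maxHeartbeats 1600000 in
-- carrier-level instance transport (`borel` on the factors vs the organ's Borel σ-algebra on the product) and ~10 ★ calls at the `cmDatum` spellings (measured)
/-- **«CHAR-FIELD-H★» — the Steinberg label HAS a Harish-Chandra character function on `H_v`.**  At a NON-SPLIT finite place `v`, under the named fact ★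
`Ch1.characterLocallyIntegrable` [Rogawski1990 §1.6 p. 5, Harish-Chandra], for ANY Borel σ-algebra instance and ANY Haar measure `νHv` on
`H_v = U(Φ₂)(L⁺_v) × U(Φ₁)(L⁺_v)` (the organ's binders), and any labels `(π₁, πSt)` of the length-two principal series `i_H(χ₂ ⊠ χ₁)` (★ `HLengthTwoLabels`, `χ₁`
continuous): there is `Θ : H_v → ℂ`, measurable, locally integrable for `νHv`, locally constant at every `G`-regular point of `H_v` (pin (P2)), with
`Tr πSt(f^H) = ∫ f^H · Θ dνHv` on `C_c^∞(H_v)` — the four (P4) clauses.  Construction: `πSt = πSt₂ ⊠ χ₁` (★ `HLengthTwoLabels.exists_eq_boxChar`; `πSt₂` a constituent of the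
admissible `i_{U(Φ₂)}(χ₂)`, hence admissible), `Θ₂` = Harish-Chandra's character of `πSt₂` (★ S1 «CHAR-FIELD★» at `N = 2`, against the Haar measure `μ₂` on `U(Φ₂)(L⁺_v)` with
`μ₂ ⊗ μ₁ = νHv`), `Θ(γ₂, γ₁) := Θ₂(γ₂) · χ₁(γ₁)`, and ★ «BOXCHAR-FN★» (`tr (ρ ⊠ χ)(f) = ∫ f · (Θ_ρ ⊗ χ)`, Fubini on the compact factor).
[cite: Rogawski1990, §1.6 p. 5; §12.1 pp. 171–172; §12.5 p. 183] [cite: HarishChandra1999AdmissibleDistributions, Thm. 16.3] -/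
theorem exists_charSt
    (hHC : Ch1.characterLocallyIntegrable)
    (w : PlacesOver L v) (hw : IsCMField.complexConj L • w.1 = w.1)
    [inst : MeasurableSpace ((UnitaryGroup.cmDatum L 2 (Matrix.of fun i j : Fin 2 => if i.val + j.val + 1 = 2 then (1 : L) else 0)).Local v ×
        (UnitaryGroup.cmDatum L 1 (Matrix.of fun i j : Fin 1 => if i.val + j.val + 1 = 1 then (1 : L) else 0)).Local v)] [BorelSpace ((UnitaryGroup.cmDatum L 2 (Matrix.of fun i j : Fin 2 => if i.val + j.val + 1 = 2 then (1 : L) else 0)).Local v ×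
        (UnitaryGroup.cmDatum L 1 (Matrix.of fun i j : Fin 1 => if i.val + j.val + 1 = 1 then (1 : L) else 0)).Local v)]
    (νHv : Measure ((UnitaryGroup.cmDatum L 2 (Matrix.of fun i j : Fin 2 => if i.val + j.val + 1 = 2 then (1 : L) else 0)).Local v ×
        (UnitaryGroup.cmDatum L 1 (Matrix.of fun i j : Fin 1 => if i.val + j.val + 1 = 1 then (1 : L) else 0)).Local v)) [νHv.IsHaarMeasure]
    (χ₂ : ↥(torusU (conjLocal L (IsCMField.complexConj L) v) (cmLocalForm L 2 v)) →* ℂˣ)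
    (χ₁ : (UnitaryGroup.cmDatum L 1 (Matrix.of fun i j : Fin 1 => if i.val + j.val + 1 = 1 then (1 : L) else 0)).Local v →* ℂˣ) (hχ₁c : Continuous fun x => ((χ₁ x : ℂˣ) : ℂ))
    (π₁ πSt : IrrClass ((UnitaryGroup.cmDatum L 2 (Matrix.of fun i j : Fin 2 => if i.val + j.val + 1 = 2 then (1 : L) else 0)).Local v ×
        (UnitaryGroup.cmDatum L 1 (Matrix.of fun i j : Fin 1 => if i.val + j.val + 1 = 1 then (1 : L) else 0)).Local v))
    (hlab : HLengthTwoLabels L v χ₂ χ₁ π₁ πSt) :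
    ∃ Θ : (UnitaryGroup.cmDatum L 2 (Matrix.of fun i j : Fin 2 => if i.val + j.val + 1 = 2 then (1 : L) else 0)).Local v ×
        (UnitaryGroup.cmDatum L 1 (Matrix.of fun i j : Fin 1 => if i.val + j.val + 1 = 1 then (1 : L) else 0)).Local v → ℂ,
      Measurable Θ ∧ LocallyIntegrable Θ νHv ∧
      (∀ x : (UnitaryGroup.cmDatum L 2 (Matrix.of fun i j : Fin 2 => if i.val + j.val + 1 = 2 then (1 : L) else 0)).Local v ×
        (UnitaryGroup.cmDatum L 1 (Matrix.of fun i j : Fin 1 => if i.val + j.val + 1 = 1 then (1 : L) else 0)).Local v, IsLocalGRegular L v x → ∀ᶠ y in 𝓝 x, Θ y = Θ x) ∧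
      ∀ fH : (UnitaryGroup.cmDatum L 2 (Matrix.of fun i j : Fin 2 => if i.val + j.val + 1 = 2 then (1 : L) else 0)).Local v ×
        (UnitaryGroup.cmDatum L 1 (Matrix.of fun i j : Fin 1 => if i.val + j.val + 1 = 1 then (1 : L) else 0)).Local v → ℂ, IsLocSmooth fH → πSt.smoothTrace νHv fH = ∫ h, fH h * Θ h ∂νHv := by
  classical
  -- Borel σ-algebras on the two factors; non-archimedean ∕ compactness instances
  letI iG₂ : MeasurableSpace ((UnitaryGroup.cmDatum L 2 (Matrix.of fun i j : Fin 2 => if i.val + j.val + 1 = 2 then (1 : L) else 0)).Local v) := borel _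
  haveI : BorelSpace ((UnitaryGroup.cmDatum L 2 (Matrix.of fun i j : Fin 2 => if i.val + j.val + 1 = 2 then (1 : L) else 0)).Local v) := ⟨rfl⟩
  letI iG₁ : MeasurableSpace ((UnitaryGroup.cmDatum L 1 (Matrix.of fun i j : Fin 1 => if i.val + j.val + 1 = 1 then (1 : L) else 0)).Local v) := borel _
  haveI : BorelSpace ((UnitaryGroup.cmDatum L 1 (Matrix.of fun i j : Fin 1 => if i.val + j.val + 1 = 1 then (1 : L) else 0)).Local v) := ⟨rfl⟩
  haveI : NonarchimedeanGroup ((UnitaryGroup.cmDatum L 2 (Matrix.of fun i j : Fin 2 => if i.val + j.val + 1 = 2 then (1 : L) else 0)).Local v) :=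
    nonarchimedeanGroup_unitaryGroupOfForm_local (E := L) (c := IsCMField.complexConj L) (N := 2) (v := v)
      (J' := (adelicForm L 2 (Matrix.of fun i j : Fin 2 => if i.val + j.val + 1 = 2 then (1 : L) else 0)).map (adeleToLocal L v))
  haveI : NonarchimedeanGroup ((UnitaryGroup.cmDatum L 1 (Matrix.of fun i j : Fin 1 => if i.val + j.val + 1 = 1 then (1 : L) else 0)).Local v) :=
    nonarchimedeanGroup_unitaryGroupOfForm_local (E := L) (c := IsCMField.complexConj L) (N := 1) (v := v)
      (J' := (adelicForm L 1 (Matrix.of fun i j : Fin 1 => if i.val + j.val + 1 = 1 then (1 : L) else 0)).map (adeleToLocal L v))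
  haveI : CompactSpace ((UnitaryGroup.cmDatum L 1 (Matrix.of fun i j : Fin 1 => if i.val + j.val + 1 = 1 then (1 : L) else 0)).Local v) := compactSpace_cmDatum_local_one_of_smul_eq L v w hw
  -- the organ's σ-algebra on the product IS the product of the factor Borel σ-algebras (second countability)
  have hinst : inst = Prod.instMeasurableSpace :=
    (‹BorelSpace ((UnitaryGroup.cmDatum L 2 (Matrix.of fun i j : Fin 2 => if i.val + j.val + 1 = 2 then (1 : L) else 0)).Local v ×
        (UnitaryGroup.cmDatum L 1 (Matrix.of fun i j : Fin 1 => if i.val + j.val + 1 = 1 then (1 : L) else 0)).Local v)›.measurable_eq).trans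
      (@BorelSpace.measurable_eq ((UnitaryGroup.cmDatum L 2 (Matrix.of fun i j : Fin 2 => if i.val + j.val + 1 = 2 then (1 : L) else 0)).Local v ×
        (UnitaryGroup.cmDatum L 1 (Matrix.of fun i j : Fin 1 => if i.val + j.val + 1 = 1 then (1 : L) else 0)).Local v) _ Prod.instMeasurableSpace Prod.borelSpace).symm
  subst hinst
  -- `πSt = πSt₂ ⊠ χ₁`, `πSt₂` admissible
  have hχ₁ : IsOpen ((χ₁.ker : Subgroup ((UnitaryGroup.cmDatum L 1 (Matrix.of fun i j : Fin 1 => if i.val + j.val + 1 = 1 then (1 : L) else 0)).Local v)) : Set ((UnitaryGroup.cmDatum L 1 (Matrix.of fun i j : Fin 1 => if i.val + j.val + 1 = 1 then (1 : L) else 0)).Local v)) :=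
    F0P3bHPrincipalSeriesJHOfUTwo.isOpen_ker_of_continuous_unitsComplex χ₁ hχ₁c
  obtain ⟨π₁₂, πSt₂, -, hSt, -, hJH⟩ := HLengthTwoLabels.exists_eq_boxChar (hχ₁ := hχ₁) hlab
  have hadm : πSt₂.IsAdmissible := by
    haveI := locallyCompactSpace_cmBorelU L 2 v
    exact F0P3XiPacketFamilyOfRecord.isAdmissible_of_isConstituentOf ((hJH πSt₂).2 (Or.inr rfl))
      (isAdmissible_cmPrincipalSeries_of_iwasawa L 2 v (exists_borel_mul_mem_cmLocalIntegralLevel L 2 v) χ₂)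
  -- Haar measures on the factors with `μ₂ ⊗ μ₁ = νHv`
  set μ₁ : Measure ((UnitaryGroup.cmDatum L 1 (Matrix.of fun i j : Fin 1 => if i.val + j.val + 1 = 1 then (1 : L) else 0)).Local v) := Measure.haar with hμ₁
  set μ₀ : Measure ((UnitaryGroup.cmDatum L 2 (Matrix.of fun i j : Fin 2 => if i.val + j.val + 1 = 2 then (1 : L) else 0)).Local v) := Measure.haar with hμ₀
  have hc := Measure.haarScalarFactor_pos_of_isHaarMeasure νHv (μ₀.prod μ₁)
  set μ₂ : Measure ((UnitaryGroup.cmDatum L 2 (Matrix.of fun i j : Fin 2 => if i.val + j.val + 1 = 2 then (1 : L) else 0)).Local v) := ((νHv.haarScalarFactor (μ₀.prod μ₁) : ℝ≥0∞)) • μ₀ with hμ₂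
  haveI : μ₂.IsHaarMeasure := Measure.IsHaarMeasure.smul μ₀ (ENNReal.coe_ne_zero.2 hc.ne') ENNReal.coe_ne_top
  have hprod : μ₂.prod μ₁ = νHv := by
    rw [hμ₂, Measure.prod_smul_left, Measure.coe_nnreal_smul]
    exact (Measure.isMulLeftInvariant_eq_smul νHv (μ₀.prod μ₁)).symm
  -- Harish-Chandra's character of `πSt₂` (★ S1 at `N = 2`)
  obtain ⟨Θ₂, hm₂, hli₂, hlc₂, htr₂⟩ :=
    F0P3cStCharTSCharField.exists_charRegular_of_characterLocallyIntegrable_of_nonsplit L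
      (Matrix.of fun i j : Fin 2 => if i.val + j.val + 1 = 2 then (1 : L) else 0) v hHC
      (antidiagOne_isHermitian L 2) (isUnit_antidiagOne_det L 2).ne_zero w hw μ₂ πSt₂
  refine ⟨fun p => Θ₂ p.1 * ((χ₁ p.2 : ℂˣ) : ℂ), F0P3cStCharTSBoxCharFn.measurable_boxCharFn hm₂ hχ₁c, ?_, ?_, ?_⟩
  · rw [← hprod]
    exact F0P3cStCharTSBoxCharFn.locallyIntegrable_boxCharFn μ₂ μ₁ hli₂ hχ₁c
  · intro x hx
    exact F0P3cStCharTSBoxCharFn.eventually_boxCharFn_eq hχ₁ (hlc₂ x.1 (isRegularElt_fst_of_isLocalGRegular L v x hx)) x.2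
  · intro fH hfH
    rw [hSt, ← hprod]
    exact F0P3cStCharTSBoxCharFn.smoothTrace_boxChar_eq_integral μ₂ μ₁ πSt₂ hadm χ₁ hχ₁ hχ₁c Θ₂ hli₂ htr₂ fH hfH


/-! ## §4 The junction-shaped corollary: ONE H-character value `Θ_St` and the (M1H) discharge for every datum pinned to it -/

set_option maxHeartbeats 1600000 in
-- as §3 (the statement repeats the organ's carrier spellings)
/-- **«H-FIELDS» FOR THE RUNG-0 ASSEMBLER.**  At a NON-SPLIT `v`, under ★ `Ch1.characterLocallyIntegrable`, for the organ's σ-algebra and Haar measure `νHv` on `H_v` and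
labels `(π₁, πSt)` (★ `HLengthTwoLabels`, `χ₁` continuous): there is ONE function `Θ_St : H_v → ℂ` with the four (P4) clauses (§3), such that EVERY §12.5 datum `𝔇` on
`(U(Φ₃)(L⁺_v), H_v)` with COMPAT `𝔇.μH = νHv`, the field value `𝔇.charH πSt = Θ_St`, the pins (P2) hRegH ∕ (P3) hEH, and hSq `𝔇.sqPacketsH = {{πSt}}` satisfies the
socket (M1H) `PacketCharHRegularity` as soon as the ONE named sentence «`Θ_St` is a stable class function on `H^r`» [§12.5 p. 183; §12.7 p. 191; §11.1] is
supplied for `𝔇.stConjH` (pin (P1): `IsLocalStablyConjH L v`). [cite: Rogawski1990, §1.6 p. 5; §12.5 pp. 183–184; §12.7 p. 191]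
[cite: HarishChandra1999AdmissibleDistributions, Thm. 16.3] -/
theorem exists_charSt_packetCharHRegularity
    (hHC : Ch1.characterLocallyIntegrable)
    (w : PlacesOver L v) (hw : IsCMField.complexConj L • w.1 = w.1)
    [MeasurableSpace (Gqs L v)]
    [∀ γ : Gqs L v, MeasurableSpace (Gqs L v ⧸ Subgroup.centralizer ({γ} : Set (Gqs L v)))]
    [MeasurableSpace (Gqs L v ⧸ Subgroup.center (Gqs L v))]
    [MeasurableSpace ((UnitaryGroup.cmDatum L 2 (Matrix.of fun i j : Fin 2 => if i.val + j.val + 1 = 2 then (1 : L) else 0)).Local v ×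
        (UnitaryGroup.cmDatum L 1 (Matrix.of fun i j : Fin 1 => if i.val + j.val + 1 = 1 then (1 : L) else 0)).Local v)] [BorelSpace ((UnitaryGroup.cmDatum L 2 (Matrix.of fun i j : Fin 2 => if i.val + j.val + 1 = 2 then (1 : L) else 0)).Local v ×
        (UnitaryGroup.cmDatum L 1 (Matrix.of fun i j : Fin 1 => if i.val + j.val + 1 = 1 then (1 : L) else 0)).Local v)]
    (νHv : Measure ((UnitaryGroup.cmDatum L 2 (Matrix.of fun i j : Fin 2 => if i.val + j.val + 1 = 2 then (1 : L) else 0)).Local v ×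
        (UnitaryGroup.cmDatum L 1 (Matrix.of fun i j : Fin 1 => if i.val + j.val + 1 = 1 then (1 : L) else 0)).Local v)) [νHv.IsHaarMeasure]
    (χ₂ : ↥(torusU (conjLocal L (IsCMField.complexConj L) v) (cmLocalForm L 2 v)) →* ℂˣ)
    (χ₁ : (UnitaryGroup.cmDatum L 1 (Matrix.of fun i j : Fin 1 => if i.val + j.val + 1 = 1 then (1 : L) else 0)).Local v →* ℂˣ) (hχ₁c : Continuous fun x => ((χ₁ x : ℂˣ) : ℂ))
    (π₁ πSt : IrrClass ((UnitaryGroup.cmDatum L 2 (Matrix.of fun i j : Fin 2 => if i.val + j.val + 1 = 2 then (1 : L) else 0)).Local v ×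
        (UnitaryGroup.cmDatum L 1 (Matrix.of fun i j : Fin 1 => if i.val + j.val + 1 = 1 then (1 : L) else 0)).Local v))
    (hlab : HLengthTwoLabels L v χ₂ χ₁ π₁ πSt) :
    ∃ Θ : (UnitaryGroup.cmDatum L 2 (Matrix.of fun i j : Fin 2 => if i.val + j.val + 1 = 2 then (1 : L) else 0)).Local v ×
        (UnitaryGroup.cmDatum L 1 (Matrix.of fun i j : Fin 1 => if i.val + j.val + 1 = 1 then (1 : L) else 0)).Local v → ℂ,
      (Measurable Θ ∧ LocallyIntegrable Θ νHv ∧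
        (∀ x : (UnitaryGroup.cmDatum L 2 (Matrix.of fun i j : Fin 2 => if i.val + j.val + 1 = 2 then (1 : L) else 0)).Local v ×
        (UnitaryGroup.cmDatum L 1 (Matrix.of fun i j : Fin 1 => if i.val + j.val + 1 = 1 then (1 : L) else 0)).Local v, IsLocalGRegular L v x → ∀ᶠ y in 𝓝 x, Θ y = Θ x) ∧
        ∀ fH : (UnitaryGroup.cmDatum L 2 (Matrix.of fun i j : Fin 2 => if i.val + j.val + 1 = 2 then (1 : L) else 0)).Local v ×
        (UnitaryGroup.cmDatum L 1 (Matrix.of fun i j : Fin 1 => if i.val + j.val + 1 = 1 then (1 : L) else 0)).Local v → ℂ, IsLocSmooth fH → πSt.smoothTrace νHv fH = ∫ h, fH h * Θ h ∂νHv) ∧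
      ∀ 𝔇 : EllipticData (Gqs L v) ((UnitaryGroup.cmDatum L 2 (Matrix.of fun i j : Fin 2 => if i.val + j.val + 1 = 2 then (1 : L) else 0)).Local v ×
        (UnitaryGroup.cmDatum L 1 (Matrix.of fun i j : Fin 1 => if i.val + j.val + 1 = 1 then (1 : L) else 0)).Local v),
        𝔇.μH = νHv → 𝔇.charH πSt = Θ →
        (∀ a, a ∈ 𝔇.regH ↔ IsLocalGRegular L v a) →
        (∀ a, a ∈ 𝔇.ellH ↔ IsLocalGRegular L v a ∧
          IsCompact ((Subgroup.centralizer ({a} : Set ((UnitaryGroup.cmDatum L 2 (Matrix.of fun i j : Fin 2 => if i.val + j.val + 1 = 2 then (1 : L) else 0)).Local v ×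
        (UnitaryGroup.cmDatum L 1 (Matrix.of fun i j : Fin 1 => if i.val + j.val + 1 = 1 then (1 : L) else 0)).Local v)) :
              Subgroup ((UnitaryGroup.cmDatum L 2 (Matrix.of fun i j : Fin 2 => if i.val + j.val + 1 = 2 then (1 : L) else 0)).Local v ×
        (UnitaryGroup.cmDatum L 1 (Matrix.of fun i j : Fin 1 => if i.val + j.val + 1 = 1 then (1 : L) else 0)).Local v)) :
            Set ((UnitaryGroup.cmDatum L 2 (Matrix.of fun i j : Fin 2 => if i.val + j.val + 1 = 2 then (1 : L) else 0)).Local v ×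
        (UnitaryGroup.cmDatum L 1 (Matrix.of fun i j : Fin 1 => if i.val + j.val + 1 = 1 then (1 : L) else 0)).Local v))) →
        𝔇.sqPacketsH = {({πSt} : Finset (IrrClass ((UnitaryGroup.cmDatum L 2 (Matrix.of fun i j : Fin 2 => if i.val + j.val + 1 = 2 then (1 : L) else 0)).Local v ×
        (UnitaryGroup.cmDatum L 1 (Matrix.of fun i j : Fin 1 => if i.val + j.val + 1 = 1 then (1 : L) else 0)).Local v)))} →
        IsStableClassFunOn 𝔇.stConjH 𝔇.regH Θ →
        𝔇.PacketCharHRegularity := by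
  obtain ⟨Θ, hm, hli, hlc, htr⟩ := exists_charSt L v hHC w hw νHv χ₂ χ₁ hχ₁c π₁ πSt hlab
  refine ⟨Θ, ⟨hm, hli, hlc, htr⟩, fun 𝔇 hμH hch hRegH hEH hSq hstab => ?_⟩
  refine packetCharHRegularity_of_pins L v νHv 𝔇 πSt hμH hRegH hEH hSq ?_ ?_
  · rw [hch]
    exact ⟨hm, hli, fun x hx => hlc x ((hRegH x).1 hx), htr⟩
  · rw [hch]
    exact hstab

/-! ## §5 (P5) «CARTAN-ELL-H» — the ∃-fact TEXT (elliptic Cartan representatives of `H_v` with Haar probability measures) kernel-checked as a `Prop`, and its projection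
to the (P5)∕S12a structure hypotheses at a datum with `cartanH := SH`, `μTH := μTHf` -/

/-- **(P5) from «CARTAN-ELL-H»**: if the datum's `cartanH`, `μTH` ARE the representatives `SH` and measures `μTHf` of the ∃-fact «CARTAN-ELL-H» (clause 1: each
representative is a COMPACT Cartan subgroup `Z_H(γ₀)`, `γ₀` `G`-regular, with a Haar PROBABILITY measure — print's «meas(Z∖T) = 1» [§12.5 p. 184]; clause 2: completeness
up to `H`-conjugacy; clause 3: pairwise non-conjugacy [§3.6]), then the (P5) structure hypotheses hold (compact, centraliser form, Haar, finite) — in particular LH4-p02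
(g6)'s S12a binders `hKH`∕`hFH`.  The statement spells the «CARTAN-ELL-H» text the rung-0 assembler takes as ONE hypothesis. [cite: Rogawski1990, §3.6 pp. 28–31; §12.5 p. 184] -/
theorem cartanH_pins_of_cartanEllH
    [MeasurableSpace (Gqs L v)]
    [∀ γ : Gqs L v, MeasurableSpace (Gqs L v ⧸ Subgroup.centralizer ({γ} : Set (Gqs L v)))]
    [MeasurableSpace (Gqs L v ⧸ Subgroup.center (Gqs L v))]
    [MeasurableSpace ((UnitaryGroup.cmDatum L 2 (Matrix.of fun i j : Fin 2 => if i.val + j.val + 1 = 2 then (1 : L) else 0)).Local v ×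
        (UnitaryGroup.cmDatum L 1 (Matrix.of fun i j : Fin 1 => if i.val + j.val + 1 = 1 then (1 : L) else 0)).Local v)]
    (hCartEllH : ∃ (SH : Finset (Subgroup ((UnitaryGroup.cmDatum L 2 (Matrix.of fun i j : Fin 2 => if i.val + j.val + 1 = 2 then (1 : L) else 0)).Local v ×
        (UnitaryGroup.cmDatum L 1 (Matrix.of fun i j : Fin 1 => if i.val + j.val + 1 = 1 then (1 : L) else 0)).Local v)))
        (μTHf : (T : Subgroup ((UnitaryGroup.cmDatum L 2 (Matrix.of fun i j : Fin 2 => if i.val + j.val + 1 = 2 then (1 : L) else 0)).Local v ×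
        (UnitaryGroup.cmDatum L 1 (Matrix.of fun i j : Fin 1 => if i.val + j.val + 1 = 1 then (1 : L) else 0)).Local v)) → Measure ↥T),
      (∀ T ∈ SH, IsCompact (T : Set ((UnitaryGroup.cmDatum L 2 (Matrix.of fun i j : Fin 2 => if i.val + j.val + 1 = 2 then (1 : L) else 0)).Local v ×
        (UnitaryGroup.cmDatum L 1 (Matrix.of fun i j : Fin 1 => if i.val + j.val + 1 = 1 then (1 : L) else 0)).Local v)) ∧
        (∃ γ₀ : (UnitaryGroup.cmDatum L 2 (Matrix.of fun i j : Fin 2 => if i.val + j.val + 1 = 2 then (1 : L) else 0)).Local v ×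
        (UnitaryGroup.cmDatum L 1 (Matrix.of fun i j : Fin 1 => if i.val + j.val + 1 = 1 then (1 : L) else 0)).Local v, IsLocalGRegular L v γ₀ ∧ T = Subgroup.centralizer ({γ₀} : Set ((UnitaryGroup.cmDatum L 2 (Matrix.of fun i j : Fin 2 => if i.val + j.val + 1 = 2 then (1 : L) else 0)).Local v ×
        (UnitaryGroup.cmDatum L 1 (Matrix.of fun i j : Fin 1 => if i.val + j.val + 1 = 1 then (1 : L) else 0)).Local v))) ∧
        (μTHf T).IsHaarMeasure ∧ IsProbabilityMeasure (μTHf T)) ∧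
      (∀ γ₀ : (UnitaryGroup.cmDatum L 2 (Matrix.of fun i j : Fin 2 => if i.val + j.val + 1 = 2 then (1 : L) else 0)).Local v ×
        (UnitaryGroup.cmDatum L 1 (Matrix.of fun i j : Fin 1 => if i.val + j.val + 1 = 1 then (1 : L) else 0)).Local v, IsLocalGRegular L v γ₀ →
        IsCompact ((Subgroup.centralizer ({γ₀} : Set ((UnitaryGroup.cmDatum L 2 (Matrix.of fun i j : Fin 2 => if i.val + j.val + 1 = 2 then (1 : L) else 0)).Local v ×
        (UnitaryGroup.cmDatum L 1 (Matrix.of fun i j : Fin 1 => if i.val + j.val + 1 = 1 then (1 : L) else 0)).Local v)) :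
            Subgroup ((UnitaryGroup.cmDatum L 2 (Matrix.of fun i j : Fin 2 => if i.val + j.val + 1 = 2 then (1 : L) else 0)).Local v ×
        (UnitaryGroup.cmDatum L 1 (Matrix.of fun i j : Fin 1 => if i.val + j.val + 1 = 1 then (1 : L) else 0)).Local v)) :
          Set ((UnitaryGroup.cmDatum L 2 (Matrix.of fun i j : Fin 2 => if i.val + j.val + 1 = 2 then (1 : L) else 0)).Local v ×
        (UnitaryGroup.cmDatum L 1 (Matrix.of fun i j : Fin 1 => if i.val + j.val + 1 = 1 then (1 : L) else 0)).Local v)) →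
        ∃ T ∈ SH, ∃ x : (UnitaryGroup.cmDatum L 2 (Matrix.of fun i j : Fin 2 => if i.val + j.val + 1 = 2 then (1 : L) else 0)).Local v ×
        (UnitaryGroup.cmDatum L 1 (Matrix.of fun i j : Fin 1 => if i.val + j.val + 1 = 1 then (1 : L) else 0)).Local v,
          Subgroup.centralizer ({x * γ₀ * x⁻¹} : Set ((UnitaryGroup.cmDatum L 2 (Matrix.of fun i j : Fin 2 => if i.val + j.val + 1 = 2 then (1 : L) else 0)).Local v ×
        (UnitaryGroup.cmDatum L 1 (Matrix.of fun i j : Fin 1 => if i.val + j.val + 1 = 1 then (1 : L) else 0)).Local v)) = T) ∧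
      (∀ T ∈ SH, ∀ T' ∈ SH, (∃ x : (UnitaryGroup.cmDatum L 2 (Matrix.of fun i j : Fin 2 => if i.val + j.val + 1 = 2 then (1 : L) else 0)).Local v ×
        (UnitaryGroup.cmDatum L 1 (Matrix.of fun i j : Fin 1 => if i.val + j.val + 1 = 1 then (1 : L) else 0)).Local v, T.map (MulAut.conj x).toMonoidHom = T') → T = T')) :
    ∃ (SH : Finset (Subgroup ((UnitaryGroup.cmDatum L 2 (Matrix.of fun i j : Fin 2 => if i.val + j.val + 1 = 2 then (1 : L) else 0)).Local v ×
        (UnitaryGroup.cmDatum L 1 (Matrix.of fun i j : Fin 1 => if i.val + j.val + 1 = 1 then (1 : L) else 0)).Local v)))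
        (μTHf : (T : Subgroup ((UnitaryGroup.cmDatum L 2 (Matrix.of fun i j : Fin 2 => if i.val + j.val + 1 = 2 then (1 : L) else 0)).Local v ×
        (UnitaryGroup.cmDatum L 1 (Matrix.of fun i j : Fin 1 => if i.val + j.val + 1 = 1 then (1 : L) else 0)).Local v)) → Measure ↥T),
      ∀ 𝔇 : EllipticData (Gqs L v) ((UnitaryGroup.cmDatum L 2 (Matrix.of fun i j : Fin 2 => if i.val + j.val + 1 = 2 then (1 : L) else 0)).Local v ×
        (UnitaryGroup.cmDatum L 1 (Matrix.of fun i j : Fin 1 => if i.val + j.val + 1 = 1 then (1 : L) else 0)).Local v),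
        𝔇.cartanH = SH → (∀ T, 𝔇.μTH T = μTHf T) →
        ∀ T ∈ 𝔇.cartanH, IsCompact (T : Set ((UnitaryGroup.cmDatum L 2 (Matrix.of fun i j : Fin 2 => if i.val + j.val + 1 = 2 then (1 : L) else 0)).Local v ×
        (UnitaryGroup.cmDatum L 1 (Matrix.of fun i j : Fin 1 => if i.val + j.val + 1 = 1 then (1 : L) else 0)).Local v)) ∧
          (∃ γ₀ : (UnitaryGroup.cmDatum L 2 (Matrix.of fun i j : Fin 2 => if i.val + j.val + 1 = 2 then (1 : L) else 0)).Local v ×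
        (UnitaryGroup.cmDatum L 1 (Matrix.of fun i j : Fin 1 => if i.val + j.val + 1 = 1 then (1 : L) else 0)).Local v, IsLocalGRegular L v γ₀ ∧ T = Subgroup.centralizer ({γ₀} : Set ((UnitaryGroup.cmDatum L 2 (Matrix.of fun i j : Fin 2 => if i.val + j.val + 1 = 2 then (1 : L) else 0)).Local v ×
        (UnitaryGroup.cmDatum L 1 (Matrix.of fun i j : Fin 1 => if i.val + j.val + 1 = 1 then (1 : L) else 0)).Local v))) ∧
          (𝔇.μTH T).IsHaarMeasure ∧ IsFiniteMeasure (𝔇.μTH T) := by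
  obtain ⟨SH, μTHf, h1, -, -⟩ := hCartEllH
  refine ⟨SH, μTHf, fun 𝔇 hS hμ T hT => ?_⟩
  rw [hS] at hT
  obtain ⟨hc, hγ, hHaar, hprob⟩ := h1 T hT
  rw [hμ T]
  exact ⟨hc, hγ, hHaar, inferInstance⟩

end U3

end Summit.HodgeConjecture.HodgeConjecture.Cruxes.H413.F0P3cStCharTSHFields

end
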